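import Summits.BirchSwinnertonDyer.BirchSwinnertonDyer.Theorems.PrintCFramBottomClassIndexLawFiveLeKrizLiBinders
import HarnessLib

/-!
# Crux `PrintCFram.BottomClassIndexLawFiveLe` (stmt-BirchSwinnertonDyer-20372), line `eisenstein-resource-bdp-line` (registry v25/v26):
# THE CLASS DATUM WITH ITS TWISTING PRESENTATION — routing kit for the genus-internal branch, part 1
# (cell `bsd-print-cfram`, width seat `bsd-line-cfram-p1-w2` g14; THEOREMS ONLY, `--supports` 20372; BSD is not proved by any of this)

HONEST FRAMING. Nothing here is a statement about BSD and no stub is closed. The seed chain of the registry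
(`HeegnerFieldSupply.stubC_of_atP_of_cuspSeed_of_exc` → … → w8 g4's W-step `stubC_of_splitPrimes_bernoulliUnit_six`) meets a class
member `W` only through w3 g2's `KrizLiBinders.exists_krizLiData_of_cmRamified`, which hands an OPAQUE class datum `(m, χ, ε, k)`:
the twisting parameter `e` of the presentation `W ∼ W₁`, `C • W₁ = A(p)^{(e)}` behind it, and the dictionary `χ = (· | |e|)` /
`[· odd]·(e | ·)`, are hidden by the existential. The genus-internal branch (bsd-idea-7 g19/g20 «genus-internal-heegner-fields»,
idea-crit-10 V#146/V#147; kernel pieces w6 g8 p702209, w7 g7 GI-2) needs exactly that link at `p = 7`: its Heegner field is the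
twisting field `K = ℚ(√e*)` itself, admissible iff `(e/7) = +1`, imaginary iff `e < 0` — read on the class datum as `χ(7) = 1`,
`χ(−1) = −1`. This file re-proves the twist layer and the `p = 7` class datum WITH the presentation and the dictionary exposed:

* §1 two Jacobi-symbol identities: `J(p | |e|) = J(e | p)` for `p ≡ 3 (mod 4)`, `e ≡ 1 (mod 4)` (quadratic reciprocity in both sign
  cases), and `J(−1 | |e|) = −1 ⟹ e < 0` for `e ≡ 1 (mod 4)`;
* §2 `exists_krizLiDataDict_of_coprime_twist` = w3 g2's `exists_krizLiData_of_coprime_twist` with the level `m` and the values `ε`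
  DISPLAYED (`m = |e|`, `ε = (· | |e|)` if `e ≡ 1 (mod 4)`; `m = 4|e|`, `ε = [· odd]·(e | ·)` otherwise) — same proof;
* §3 `exists_krizLiDataDict_of_cmRamified_seven`: for every elliptic `W/ℚ` with CM and `CMRamified W 7`, the class datum of
  `exists_krizLiData_of_cmRamified` (all ten conjuncts verbatim, `p := 7`) TOGETHER WITH `e` squarefree, `7 ∤ e`, `W ∼ W₁` globally
  minimal, `C • W₁ = cm7^{(e)}`, the displayed dictionary, and its two odd-level consequences `χ(−1) = −1 ⟹ e < 0`,
  `χ(7) = 1 ⟹ J(e | 7) = 1`.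

Part 2 (`…GenusInternalRoutingSupply`) threads the genus-internal carve-out through the seed chain and uses §3 in the W-step;
part 3 (`…GenusInternalRoutingEndState`) feeds v18's B2′ slot. beyond-print theorem: NO.
References: [KrizLi2019] Thm. 1.20, Rem. 1.21, §2 (p. 12); [Cox2013] §1.C Lemma 1.14; [IrelandRosen1990] Prop. 5.2.2 (Jacobi reciprocity);
[SilvermanAEC2009] X.5 Prop. 5.4; registry `Cruxes/BottomClassIndexLawFiveLe/Lines/eisenstein_resource_bdp_line.lean`.
-/

noncomputable section

-- summit-side namespace `Summit.BirchSwinnertonDyer.BirchSwinnertonDyer.…` (single-conjunct summit, D-0017 layout)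
set_option linter.dupNamespace false
set_option autoImplicit false

open scoped Classical NumberTheorySymbols
open NumberField IsDedekindDomain IsDedekindDomain.HeightOneSpectrum WeierstrassCurve DirichletCharacter
open Literature.NumberTheory.EllipticCurves Literature.NumberTheory.EllipticCurves.KrizLi2019
open Literature.NumberTheory.EllipticCurves.Rank1Residual Literature.NumberTheory.QuadraticFields
open Summit.BirchSwinnertonDyer.Rank1Residual Summit.BirchSwinnertonDyer.Rank1Residual.X12.O11
  Summit.BirchSwinnertonDyer.Rank1Residual.X12.O11.RouteU

namespace Summit.BirchSwinnertonDyer.BirchSwinnertonDyer.Theorems.PrintCFram.GenusInternalRouting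

open Summit.BirchSwinnertonDyer.BirchSwinnertonDyer.Theorems.PrintCFram
open Summit.BirchSwinnertonDyer.BirchSwinnertonDyer.Theorems.PrintCFram.KrizLiBinders

variable {p : ℕ} [hp : Fact p.Prime]

/-! ## §1 Two Jacobi-symbol identities -/

omit hp in
/-- **`J(p | |e|) = J(e | p)` for `p ≡ 3 (mod 4)` and `e ≡ 1 (mod 4)`** (both signs of `e`): for `e > 0` this is reciprocity with
`e ≡ 1 (mod 4)`; for `e < 0`, `|e| ≡ 3 (mod 4)` and `J(p | |e|) = −J(|e| | p) = J(−1 | p)·J(|e| | p) = J(e | p)`.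
[cite: IrelandRosen1990, Prop. 5.2.2 (Jacobi reciprocity) and Prop. 5.2.3] -/
theorem jacobiSym_natCast_natAbs_eq_of_mod_four (hp3 : p % 4 = 3) {e : ℤ} (he4 : e % 4 = 1) :
    J((p : ℤ) | e.natAbs) = J(e | p) := by
  have hpodd : Odd p := Nat.odd_iff.mpr (by omega)
  rcases lt_or_ge 0 e with hpos | hneg
  · -- `e > 0`: `|e| = e ≡ 1 (mod 4)`
    have hn : (e.natAbs : ℤ) = e := Int.natAbs_of_nonneg hpos.le
    have hn4 : e.natAbs % 4 = 1 := by omega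
    rw [jacobiSym.quadratic_reciprocity_one_mod_four' hpodd hn4, hn]
  · -- `e < 0`: `|e| = −e ≡ 3 (mod 4)`
    have he0 : e ≠ 0 := by rintro rfl; simp at he4
    have hlt : e < 0 := lt_of_le_of_ne hneg he0
    have hn : (e.natAbs : ℤ) = -e := Int.ofNat_natAbs_of_nonpos hlt.le
    have hn4 : e.natAbs % 4 = 3 := by omega
    rw [jacobiSym.quadratic_reciprocity_three_mod_four hp3 hn4, hn, jacobiSym.neg _ hpodd,
      ZMod.χ₄_nat_three_mod_four hp3]
    ring

omit hp in
/-- **`J(−1 | |e|) = −1 ⟹ e < 0` for `e ≡ 1 (mod 4)`**: if `e > 0` then `|e| ≡ 1 (mod 4)` and `J(−1 | |e|) = χ₄(|e|) = 1`.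
[cite: IrelandRosen1990, Prop. 5.2.2] -/
theorem neg_of_jacobiSym_neg_one_natAbs {e : ℤ} (he4 : e % 4 = 1) (h : J(-1 | e.natAbs) = -1) : e < 0 := by
  rcases lt_or_ge e 0 with hlt | hge
  · exact hlt
  exfalso
  have he0 : e ≠ 0 := by rintro rfl; simp at he4
  have hpos : 0 < e := lt_of_le_of_ne hge he0.symm
  have hn4 : e.natAbs % 4 = 1 := by
    have hn : (e.natAbs : ℤ) = e := Int.natAbs_of_nonneg hpos.le
    omega
  have hodd : Odd e.natAbs := Nat.odd_iff.mpr (by omega)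
  rw [jacobiSym.at_neg_one hodd, ZMod.χ₄_nat_one_mod_four hn4] at h
  norm_num at h

/-! ## §2 The twist layer with the level and the values displayed -/

/-- **Character data from a coprime twisting presentation, WITH THE DICTIONARY** (w3 g2's `exists_krizLiData_of_coprime_twist`, same
proof, the level `m` and the integer values `ε` displayed). Let `p` be an odd prime, `E/ℚ` elliptic with good reduction at every prime
`≠ p` and trace form `a_ℓ(E) ≡ ℓ^{k₁} + ℓ^{k₂} (mod p)` at every prime `ℓ ≠ p`; let `W ∼ W₁` be `ℚ`-isogenous elliptic curves with
`C • W₁ = E^{(e)}`, `e` squarefree, `p ∤ e`. Then there are `m` coprime to `p`, a PRIMITIVE QUADRATIC `ℚ_p`-valued character `χ` mod `m`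
with integer values `ε`, `χ(−1) = ±1`, the trace form `a_ℓ(W) ≡ ε(ℓ)(ℓ^{k₁} + ℓ^{k₂})` at every prime `ℓ ≠ p`, `W` good at every prime
`ℓ ≠ p`, `ℓ ∤ m`, AND: either `e ≡ 1 (mod 4)`, `m = |e|`, `ε = (· | |e|)`, or `e ≡ 2, 3 (mod 4)`, `m = 4|e|`, `ε = [· odd]·(e | ·)`.
[cite: SilvermanAEC2009, X.2 and Exercise 10.16, VII.5 Prop. 5.1(a)] [cite: Cox2013, §1.C Lemma 1.14] [cite: KrizLi2019, §2 (p. 12)] -/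
theorem exists_krizLiDataDict_of_coprime_twist (hp2 : p ≠ 2) (E : WeierstrassCurve ℚ) [E.IsElliptic] (k₁ k₂ : ℕ)
    (hgood : ∀ (q : ℕ) [Fact q.Prime], q ≠ p → E.HasGoodReductionAtPrime q)
    (hbase : ∀ (ℓ : ℕ) [Fact ℓ.Prime], ℓ ≠ p → (E.LFunction ℓ : ZMod p) = (ℓ : ZMod p) ^ k₁ + (ℓ : ZMod p) ^ k₂)
    (W W₁ : WeierstrassCurve ℚ) [W.IsElliptic] [W₁.IsElliptic] (hiso : IsIsogenous W W₁)
    {e : ℤ} (hsq : Squarefree e) (hpe : ¬ (p : ℤ) ∣ e)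
    (hW₁ : ∃ C : VariableChange ℚ, C • W₁ = E.quadraticTwist (e : ℚ)) :
    ∃ (m : ℕ) (_ : NeZero m) (χ : DirichletCharacter ℚ_[p] m) (ε : ℕ → ℤ),
      m.Coprime p ∧ χ.IsPrimitive ∧ χ.IsQuadratic ∧ (∀ a : ℕ, χ (a : ZMod m) = (ε a : ℚ_[p])) ∧
      (χ (-1) = 1 ∨ χ (-1) = -1) ∧
      (∀ ℓ : ℕ, ℓ.Prime → ℓ ≠ p →
        ((W.LFunction ℓ : ℤ) : ZMod p) = (ε ℓ : ZMod p) * ((ℓ : ZMod p) ^ k₁ + (ℓ : ZMod p) ^ k₂)) ∧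
      (∀ ℓ : ℕ, (hℓ : ℓ.Prime) → ℓ ≠ p → ¬ ℓ ∣ m → (haveI := Fact.mk hℓ; W.HasGoodReductionAtPrime ℓ)) ∧
      ((e % 4 = 1 ∧ m = e.natAbs ∧ ∀ a : ℕ, ε a = J((a : ℤ) | e.natAbs)) ∨
        ((e % 4 = 2 ∨ e % 4 = 3) ∧ m = 4 * e.natAbs ∧ ∀ a : ℕ, ε a = if Even a then (0 : ℤ) else J(e | a))) := by
  have hpp : p.Prime := hp.out
  have he0 : e ≠ 0 := hsq.ne_zero
  have heQ : (e : ℚ) ≠ 0 := by exact_mod_cast he0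
  obtain ⟨C, hC⟩ := hW₁
  have hLW : W.LFunction = W₁.LFunction := hiso.LFunction_eq
  haveI := E.isElliptic_quadraticTwist heQ
  have hpe' : ¬ p ∣ e.natAbs := fun h => hpe (Int.natCast_dvd.mpr h)
  have hcopE : e.natAbs.Coprime p := ((Nat.Prime.coprime_iff_not_dvd hpp).mpr hpe').symm
  have hp4 : ¬ p ∣ 4 := fun h => hp2 ((Nat.prime_dvd_prime_iff_eq hpp Nat.prime_two).mp
    (hpp.dvd_of_dvd_pow (show p ∣ 2 ^ 2 by simpa using h)))
  have hcop4 : (4 : ℕ).Coprime p := ((Nat.Prime.coprime_iff_not_dvd hpp).mpr hp4).symm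
  -- `χ(−1) = ±1` for a quadratic character (−1 is a unit)
  have hsign : ∀ {n : ℕ} (θ : DirichletCharacter ℚ_[p] n), θ.IsQuadratic → θ (-1) = 1 ∨ θ (-1) = -1 := by
    intro n θ hθ
    rcases hθ (-1) with h | h | h
    · exact absurd h (isUnit_one.neg.map θ).ne_zero
    · exact Or.inl h
    · exact Or.inr h
  -- good reduction of `W` at a prime `ℓ ≠ p` from good reduction of `E^{(e)}` at the place over `ℓ`
  have hgoodW : ∀ ℓ : ℕ, (hℓ : ℓ.Prime) → ℓ ≠ p →
      (∀ v : HeightOneSpectrum (𝓞 ℚ), (Rat.HeightOneSpectrum.primesEquiv v : ℕ) = ℓ →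
        (E.quadraticTwist (e : ℚ)).HasGoodReductionAt v) →
      (haveI := Fact.mk hℓ; W.HasGoodReductionAtPrime ℓ) := by
    intro ℓ hℓ hne htw
    haveI := Fact.mk hℓ
    obtain ⟨v, rfl⟩ : ∃ v : HeightOneSpectrum (𝓞 ℚ), (Rat.HeightOneSpectrum.primesEquiv v : ℕ) = ℓ :=
      ⟨Rat.HeightOneSpectrum.primesEquiv.symm ⟨ℓ, hℓ⟩, by rw [Equiv.apply_symm_apply]⟩
    have h1 : (C • W₁).HasGoodReductionAt v := by rw [hC]; exact htw v rfl
    have h2 : W₁.HasGoodReductionAt v := (hasGoodReductionAt_smul_iff_holds v W₁ C).mp h1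
    have h3 : W₁.HasGoodReductionAtPrime (Rat.HeightOneSpectrum.primesEquiv v : ℕ) :=
      (hasGoodReductionAtPrime_iff_hasGoodReductionAt_ringOfIntegers v W₁).mpr h2
    exact (hiso.hasGoodReductionAtPrime_iff _).mpr h3
  by_cases he4 : e % 4 = 1
  · /- ODD discriminant `D = e`: `χ = (· | |e|)` mod `m = |e|` -/
    haveI : NeZero e.natAbs := ⟨Int.natAbs_ne_zero.mpr he0⟩
    obtain ⟨χ, hχ⟩ := exists_jacobiCharPadic (p := p) e.natAbs
    have hodd : Odd e.natAbs := by
      rw [Int.natAbs_odd, Int.odd_iff]; omega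
    have hsqn : Squarefree e.natAbs := Int.squarefree_natAbs.mpr hsq
    refine ⟨e.natAbs, inferInstance, χ, fun a => J((a : ℤ) | e.natAbs), ?_, isPrimitive_of_forall_eq_jacobiSym hχ hodd hsqn,
      isQuadratic_of_forall_eq_jacobiSym hχ, hχ, hsign χ (isQuadratic_of_forall_eq_jacobiSym hχ), ?_, ?_,
      Or.inl ⟨he4, rfl, fun a => rfl⟩⟩
    · -- `(|e|, p) = 1`
      exact hcopE
    · -- trace form at every `ℓ ≠ p`
      intro ℓ hℓ hne
      haveI := Fact.mk hℓ
      rw [hLW]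
      exact EisensteinTraceForm.lFunction_twist_mod_of_traceForm E p k₁ k₂ hgood hbase W₁ he4 hsq hpe ⟨C, hC⟩ ℓ hne
    · -- good reduction of `W` at `ℓ ≠ p`, `ℓ ∤ |e|`
      intro ℓ hℓ hne hℓm
      refine hgoodW ℓ hℓ hne fun v hv => ?_
      refine hasGoodReductionAt_quadraticTwist_of_emod_four_any E v he4 ?_
        (hasGoodReductionAt_of_forall_prime_ne E hgood v (by rw [hv]; exact hne))
      rw [hv]
      exact fun h => hℓm (Int.natCast_dvd.mp h)
  · /- EVEN discriminant `D = 4e` (`e ≡ 2, 3 (mod 4)`): `χ = [· odd]·(e | ·)` mod `m = 4|e|` -/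
    have he4' : e % 4 = 2 ∨ e % 4 = 3 := by
      have h0 : e % 4 ≠ 0 := by
        intro h0
        have h4 : (2 : ℤ) * 2 ∣ e := by omega
        have := hsq 2 h4
        rcases Int.isUnit_iff.mp this with h | h <;> omega
      omega
    haveI hm0 : NeZero (4 * e.natAbs) := ⟨Nat.mul_ne_zero (by norm_num) (Int.natAbs_ne_zero.mpr he0)⟩
    obtain ⟨χ, hχ⟩ := exists_kroneckerFourPadic (p := p) e he0 (rfl : 4 * e.natAbs = 4 * e.natAbs)
    have hχq := isQuadratic_of_forall_eq_kroneckerFour hχ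
    refine ⟨4 * e.natAbs, hm0, χ, fun a => if Even a then (0 : ℤ) else J(e | a), ?_,
      isPrimitive_of_forall_eq_kroneckerFour' rfl he4' hsq hχ, hχq, hχ, hsign χ hχq, ?_, ?_,
      Or.inr ⟨he4', rfl, fun a => rfl⟩⟩
    · -- `(4|e|, p) = 1`
      exact Nat.Coprime.mul_left hcop4 hcopE
    · -- trace form at every `ℓ ≠ p`, via a quadratic field of discriminant `4e`
      intro ℓ hℓ hne
      haveI := Fact.mk hℓ
      obtain ⟨M, _, _, hM2, hdM⟩ := Quadratic.exists_numberField_discr_eq (D := 4 * e)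
        (Or.inr ⟨dvd_mul_right 4 e, by rw [Int.mul_ediv_cancel_left _ (by norm_num)]; exact he4',
          by rw [Int.mul_ediv_cancel_left _ (by norm_num)]; exact hsq⟩)
      have h4 : 4 ∣ NumberField.discr M := by rw [hdM]; exact dvd_mul_right 4 e
      have hdiv : NumberField.discr M / 4 = e := by rw [hdM, Int.mul_ediv_cancel_left _ (by norm_num)]
      have hgoodv : ∀ v : HeightOneSpectrum (𝓞 ℚ),
          ((Rat.HeightOneSpectrum.primesEquiv v : ℕ) : ℤ) ∣ NumberField.discr M → E.HasGoodReductionAt v := by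
        intro v hvD
        refine hasGoodReductionAt_of_forall_prime_ne E hgood v fun hvp => hpe ?_
        rw [hdM, hvp] at hvD
        exact (Int.Prime.dvd_mul' hpp hvD).resolve_left (fun h => hp4 (by exact_mod_cast h))
      -- `W₁ ≅ E^{(e)} ≅ E^{(4e)} = E^{(d_M)}`
      obtain ⟨C₂, hC₂⟩ := E.exists_variableChange_quadraticTwist_mul_sq (e : ℚ) 2 two_ne_zero
      have hC₂' : E.quadraticTwist ((4 : ℚ) * e) = C₂ • E.quadraticTwist (e : ℚ) := by
        rw [hC₂]; congr 1; ring
      have h1 : (E.quadraticTwist (NumberField.discr M : ℚ)).LFunction = W.LFunction := by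
        rw [hdM]
        push_cast
        rw [hC₂', LFunction_smul, ← hC, LFunction_smul, hLW]
      rw [← h1, E.LFunction_quadraticTwist_apply_of_four_dvd_discr M hM2 h4 hgoodv ℓ, hdiv]
      push_cast
      rw [hbase ℓ hne]
    · -- good reduction of `W` at `ℓ ≠ p`, `ℓ ∤ 4|e|` (so `ℓ` odd, `ℓ ∤ e`)
      intro ℓ hℓ hne hℓm
      have hℓ2 : ℓ ≠ 2 := by rintro rfl; exact hℓm (dvd_mul_of_dvd_left (by norm_num) _)
      have hℓe : ¬ (ℓ : ℤ) ∣ e := fun h => hℓm (dvd_mul_of_dvd_right (Int.natCast_dvd.mp h) 4)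
      refine hgoodW ℓ hℓ hne fun v hv => ?_
      exact hasGoodReductionAt_quadraticTwist_of_odd_any E v (by rw [hv]; exact hℓ2) (by rw [hv]; exact hℓe)
        (hasGoodReductionAt_of_forall_prime_ne E hgood v (by rw [hv]; exact hne))

/-! ## §3 The class datum at `p = 7` with its twisting presentation and the dictionary -/

/-- **THE CLASS DATUM AT `p = 7` WITH ITS TWISTING PRESENTATION.** For every elliptic `W/ℚ` with CM and `7` CM-ramified
(the two leaf classes `j = −3375`, `j = 16581375`): the class datum of w3 g2's `KrizLiBinders.exists_krizLiData_of_cmRamified` — `m`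
coprime to `7`, a primitive quadratic `ℚ_7`-valued `χ` mod `m` with integer values `ε`, `k ∈ {2, 5}` making `χ·ω^k` odd, the trace form
`a_ℓ(W) ≡ ε(ℓ)(ℓ^k + ℓ^{7−k}) (mod 7)` at every prime `ℓ ≠ 7`, good reduction at every `ℓ ≠ 7`, `ℓ ∤ m` (all ten conjuncts VERBATIM,
`p := 7`) — TOGETHER WITH the twisting presentation behind it (`e` squarefree, `7 ∤ e`, `W ∼ W₁` globally minimal,
`C • W₁ = cm7^{(e)}`), the displayed dictionary (`m = |e|`, `ε = (· | |e|)` for `e ≡ 1 (mod 4)`; `m = 4|e|`, `ε = [· odd]·(e | ·)`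
otherwise) and, at odd level, its two consequences `χ(−1) = −1 ⟹ e < 0` and `χ(7) = 1 ⟹ J(e | 7) = 1` — i.e. «the class character is odd
and takes the value `1` at `7`» ⟹ «the twisting field `ℚ(√e)` is imaginary and `7` splits in it», the admissibility condition of the
genus-internal branch. [cite: KrizLi2019, Thm. 1.20, Rem. 1.21 and §2 (p. 12)] [cite: Cox2013, §1.C Lemma 1.14] [cite: SilvermanAEC2009, X.5 Prop. 5.4] -/
theorem exists_krizLiDataDict_of_cmRamified_seven [h7 : Fact (Nat.Prime 7)] (W : WeierstrassCurve ℚ) [W.IsElliptic]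
    (hCM : W.HasCM) (hram : CMRamified W 7) :
    ∃ (m : ℕ) (_ : NeZero m) (χ : DirichletCharacter ℚ_[7] m) (ε : ℕ → ℤ) (k : ℕ) (e : ℤ)
      (W₁ : WeierstrassCurve ℚ) (_ : W₁.IsElliptic) (_ : W₁.IsGloballyMinimal) (C : VariableChange ℚ),
      (m.Coprime 7 ∧ χ.IsPrimitive ∧ χ.IsQuadratic ∧ (∀ a : ℕ, χ (a : ZMod m) = (ε a : ℚ_[7])) ∧
        (k = (7 + 1) / 4 ∨ k = (3 * 7 - 1) / 4) ∧ 2 ≤ k ∧ k ≤ 7 - 2 ∧ χ (-1) * (-1) ^ k = -1 ∧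
        (∀ ℓ : ℕ, ℓ.Prime → ℓ ≠ 7 →
          ((W.LFunction ℓ : ℤ) : ZMod 7) = (ε ℓ : ZMod 7) * ((ℓ : ZMod 7) ^ k + (ℓ : ZMod 7) ^ (7 - k))) ∧
        (∀ ℓ : ℕ, (hℓ : ℓ.Prime) → ℓ ≠ 7 → ¬ ℓ ∣ m → (haveI := Fact.mk hℓ; W.HasGoodReductionAtPrime ℓ))) ∧
      (Squarefree e ∧ ¬ (7 : ℤ) ∣ e ∧ IsIsogenous W W₁ ∧ C • W₁ = cm7.quadraticTwist (e : ℚ)) ∧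
      ((e % 4 = 1 ∧ m = e.natAbs ∧ ∀ a : ℕ, ε a = J((a : ℤ) | e.natAbs)) ∨
        ((e % 4 = 2 ∨ e % 4 = 3) ∧ m = 4 * e.natAbs ∧ ∀ a : ℕ, ε a = if Even a then (0 : ℤ) else J(e | a))) ∧
      (¬ 2 ∣ m → (χ (-1) = -1 → e < 0) ∧ (χ (7 : ZMod m) = 1 → J(e | 7) = 1)) := by
  have h5 : 5 ≤ 7 := by norm_num
  obtain ⟨hCM7, -, -, -, -, -⟩ := hasCM_bases
  obtain ⟨hr7, -, -, -, -, -⟩ := cmRamified_bases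
  -- the `j`-class: isogenous to a curve with `j = j(cm7)`
  have hW : ∃ (W' : WeierstrassCurve ℚ) (_ : W'.IsElliptic), IsIsogenous W W' ∧ W'.j = cm7.j := by
    rcases AnchorReduction.classes_of_cmRamified W h7.out hCM hram h5 with
      ⟨-, hj | hj⟩ | ⟨h, -⟩ | ⟨h, -⟩ | ⟨h, -⟩ | ⟨h, -⟩ | ⟨h, -⟩
    · exact ⟨W, inferInstance, isIsogenous_self W, by rw [hj, j_cm7]⟩
    · obtain ⟨W', hW'E, hiso, -, hj'⟩ := exists_isIsogenous_LFunction_eq_cm28 W hj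
      exact ⟨W', hW'E, hiso, by rw [hj', j_cm7]⟩
    all_goals omega
  obtain ⟨W', hW'E, hiso', hj⟩ := hW
  -- a twisting parameter coprime to `7`, up to isogeny
  obtain ⟨e, -, hsq, hpe, W₁, hW₁E, hW₁M, C, hC, hiso₁⟩ :=
    RelativeAnchorTransfer.exists_coprime_twist_isIsogenous (W := W') hCM7 hr7 h5 hj
  have hiso : IsIsogenous W W₁ := hiso'.trans' hiso₁
  obtain ⟨m, hm, χ, ε, hmp, hχ, hχq, hε, hsign, htr, hgoodW, hdict⟩ :=
    exists_krizLiDataDict_of_coprime_twist (p := 7) (by norm_num) cm7 ((7 + 1) / 4) ((3 * 7 - 1) / 4)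
      (fun q _ h => RouteU.hasGoodReductionAtPrime_cm7 q h)
      (fun ℓ _ h => by simpa using RouteU.lFunction_cm7_mod_seven ℓ h) W W₁ hiso hsq hpe ⟨C, hC⟩
  haveI := hm
  -- the odd exponent
  obtain ⟨k, hk, hodd⟩ := exists_exponent_odd hsign (show _root_.Odd ((7 + 1) / 4 + (3 * 7 - 1) / 4) from ⟨3, by norm_num⟩)
  refine ⟨m, hm, χ, ε, k, e, W₁, hW₁E, hW₁M, C, ⟨hmp, hχ, hχq, hε, hk, ?_, ?_, hodd, ?_, hgoodW⟩,
    ⟨hsq, hpe, hiso, hC⟩, hdict, ?_⟩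
  · rcases hk with rfl | rfl <;> norm_num
  · rcases hk with rfl | rfl <;> norm_num
  · intro ℓ hℓ hne
    rw [htr ℓ hℓ hne]
    rcases hk with rfl | rfl
    · have e2 : 7 - (7 + 1) / 4 = (3 * 7 - 1) / 4 := by norm_num
      rw [e2]
    · have e2 : 7 - (3 * 7 - 1) / 4 = (7 + 1) / 4 := by norm_num
      rw [e2, add_comm]
  · -- the two consequences of the dictionary at odd level
    intro hm2
    rcases hdict with ⟨he4, hme, hεJ⟩ | ⟨-, hme, -⟩
    · subst hme
      refine ⟨fun hneg => ?_, fun hsev => ?_⟩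
      · -- `χ(−1) = J(−1 | |e|)`
        have h1m : 1 ≤ e.natAbs := Nat.one_le_iff_ne_zero.mpr (NeZero.ne _)
        have h1 : ((e.natAbs - 1 : ℕ) : ZMod e.natAbs) = -1 := by
          rw [Nat.cast_sub h1m, Nat.cast_one, ZMod.natCast_self, zero_sub]
        have hmod : ((e.natAbs - 1 : ℕ) : ℤ) % (e.natAbs : ℕ) = (-1 : ℤ) % (e.natAbs : ℕ) := by
          rw [Nat.cast_sub h1m, Nat.cast_one, show ((e.natAbs : ℕ) : ℤ) - 1 = -1 + (e.natAbs : ℕ) * 1 by ring,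
            Int.add_mul_emod_self_left]
        have hval : (J(-1 | e.natAbs) : ℚ_[7]) = -1 := by
          rw [← jacobiSym.mod_left' hmod, ← hεJ, ← hε, h1, hneg]
        exact neg_of_jacobiSym_neg_one_natAbs he4 (by exact_mod_cast hval)
      · -- `χ(7) = J(7 | |e|) = J(e | 7)`
        have hval : (J(((7 : ℕ) : ℤ) | e.natAbs) : ℚ_[7]) = 1 := by
          rw [← hεJ, ← hε]
          simpa using hsev
        rw [← jacobiSym_natCast_natAbs_eq_of_mod_four (p := 7) (by norm_num) he4]
        exact_mod_cast hval
    · exact absurd (hme ▸ dvd_mul_of_dvd_left (by norm_num : 2 ∣ 4) e.natAbs) hm2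

end Summit.BirchSwinnertonDyer.BirchSwinnertonDyer.Theorems.PrintCFram.GenusInternalRouting

end
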